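import Summits.Ventures.HSemireg.WedgeHankelBoxSiegelIdealKernel

/-!
# Venture HSemireg — THE BOX SIEGEL IDEAL, an explicit basis: the BOX-STANDARD MONOMIALS `Π_i x^{(i)}_{S_i∖A_i} ∧ y^{(i)}_{A_i}` are LINEARLY
# INDEPENDENT and span the complement `boxStd` of the box Siegel ideal; their number is `[t^k] Π_i G_{m_i}(t)`

HONEST FRAMING. Part of the Lean index of the computation cell `pub-hsemireg` (seat p10 gen 12, Sunday typer «UNIFORM-IN-n»).
Finite-dimensional EXTERIOR ALGEBRA over a field ONLY: no variety, no cohomology theory, no sheaf, no Ext group, no semiregularity map; nothing here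
says that HC / HC_CM / HC_AV holds; no Literature fact is declared or used.  Custodian versions as in `WedgeHankelBoxSiegelIdeal` (1/3); the dictionary
(`x^{(i)}_a ↔ ∂_a`, `y^{(i)}_a ↔ dz̄_a` on the factor `X_i`) is QUOTED, never asserted.

THIS FILE (namespace `Summit.Ventures.HSemireg.Wedge.HankelBoxSiegelIdeal` continued; imports (2/3) `WedgeHankelBoxSiegelIdealKernel`).  (2/3) proved that the
recursively defined box-standard span `boxStd` is a complement of the box Siegel ideal with `dim = [t^k] Π_i G_{m_i}`.  Here the SPANNING FAMILY is made explicit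
and proved to be a BASIS:
* §16 the index `BIdx j k` (per factor `i < j` a set `S_i` of pairs and a `y`-count `b_i ≤ |S_i|`, `Σ |S_i| = k`; later factors idle), the one-factor standard monomial
  `smon S b = x_{S∖A} ∧ y_A` (`= rep`, `A = canon S b`), the BOX-STANDARD MONOMIAL `stdmon j f = Π_{i<j} emb_i(smon (S_i, b_i))` (gen 6's ordered product);
  `stdmon_succ`, `stdmon_congr`; **`stdmon_mem_boxStd`** and **`boxStd_le_span_stdmon`**: `boxStd_j^k = span{stdmon j f : f ∈ BIdx j k}` (`span_stdmon`).
* §17 **`linearIndependent_stdmon`: the box-standard monomials of the first `j ≤ n` factors are LINEARLY INDEPENDENT** — induction on `j` with th-7's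
  `linearIndependent_mul` (products of independent homogeneous families on disjoint blocks, degree read on the first block) and gen 11's `linearIndependent_rep`;
  hence **`card_BIdx`: `#BIdx j k = cnt j k = [t^k] Π_{i<j} G_{m_i}`** (the count of (2/3), now as the cardinality of an explicit basis — no separate counting
  argument) and **`exteriorPower_eq_span_stdmon_sup`: `⋀^k = span{box-standard monomials} ⊕ boxSiegelIdeal_k`** with `#{box-standard monomials of degree k}
  = [t^k] Π_i G_{m_i}(t)`.
NOT typed here (sequel): the Dolbeault-type (bidegree) refinement.  Class side only.
-/

open Module

namespace Summit.Ventures.HSemireg.Wedge.HankelBoxSiegelIdeal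

open Summit.Ventures.HSemireg.Wedge Summit.Ventures.HSemireg.Wedge.Kunneth Summit.Ventures.HSemireg.Wedge.MixedBox
  Summit.Ventures.HSemireg.Wedge.HankelSiegel Summit.Ventures.HSemireg.Wedge.HankelSiegelIdeal
  Summit.Ventures.HSemireg.Wedge.HankelBox

variable (K : Type*) [Field K]

/-! ## §16. Box-standard monomials -/

section Generic

variable {I : Type*} [LinearOrder I] [Fintype I]

omit [LinearOrder I] [Fintype I] in
/-- the ordered product only sees the slots below `N`. -/
lemma prodR_congr {f g : ℕ → HT K I} : ∀ {N : ℕ}, (∀ i < N, f i = g i) → prodR K f N = prodR K g N := by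
  intro N
  induction N with
  | zero => intro; rfl
  | succ N ih => intro h; rw [prodR_succ, prodR_succ, ih fun i hi => h i (by omega), h N (by omega)]

/-- `Hom(∅, 0) ≤ K·1` and `Hom(∅, k+1) = 0`: on no generators only the constants survive. -/
lemma Hom_empty_le (k : ℕ) : Hom K I ∅ k ≤ K ∙ (1 : HT K I) := by
  rw [Hom, Submodule.span_le]
  rintro _ ⟨s, ⟨hs, -⟩, rfl⟩
  have h1 : B K I (∅ : Finset I) = 1 := by
    rw [B, ExteriorAlgebra.basis_apply_ofCard (b K I) Finset.card_empty]; simp [ExteriorAlgebra.ιMulti_family]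
  show B K I s ∈ _
  rw [Finset.subset_empty.mp hs, h1]
  exact Submodule.mem_span_singleton_self _

/-- `Hom(∅, k) = 0` for `k ≠ 0`. -/
lemma Hom_empty_of_ne {k : ℕ} (hk : k ≠ 0) : Hom K I ∅ k = ⊥ := by
  rw [Hom, Submodule.span_eq_bot]
  rintro _ ⟨s, ⟨hs, hc⟩, rfl⟩
  rw [Finset.subset_empty.mp hs, Finset.card_empty] at hc
  exact absurd hc.symm hk

end Generic

section Box

variable {n : ℕ} (m : Fin n → ℕ)

/-- the ONE-FACTOR STANDARD MONOMIAL with pair set `S` and `y`-count `b`: `x_{S∖A} ∧ y_A`, `A = canon S b` (gen 11's `rep`, with the degree left implicit). -/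
noncomputable def smon {M : ℕ} (S : Finset (Fin M)) (b : ℕ) : HT K (Hankel.In M) :=
  B K (Hankel.In M) (xs (S \ canon S b)) * B K (Hankel.In M) (ys (canon S b))

/-- `smon` is gen 11's `rep`. -/
lemma smon_eq_rep {M k : ℕ} (S : Finset (Fin M)) (hS : S.card = k) (b : Fin (k + 1)) : smon K S b = rep K (⟨S, hS⟩, b) := rfl

/-- a standard monomial lies in the standard span of its degree. -/
lemma smon_mem_repSpan {M : ℕ} (S : Finset (Fin M)) {b : ℕ} (hb : b ≤ S.card) : smon K S b ∈ repSpan K M S.card := by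
  rw [smon_eq_rep K S rfl ⟨b, Nat.lt_succ_of_le hb⟩]
  exact Submodule.subset_span ⟨_, rfl⟩

/-- slot data of a box-standard monomial: per factor a set of pairs and a `y`-count. -/
abbrev BI : Type := (i : Fin n) → Finset (Fin (m i)) × Fin (m i + 1)

/-- **the index of the BOX-STANDARD MONOMIALS of the first `j` factors in degree `k`**: factors `i ≥ j` idle (`(∅, 0)`), `y`-counts at most the set sizes, total
size `k`. -/
abbrev BIdx (j k : ℕ) : Type :=
  {f : BI m // (∀ i : Fin n, j ≤ (i : ℕ) → f i = (∅, 0)) ∧ (∀ i : Fin n, ((f i).2 : ℕ) ≤ (f i).1.card) ∧ ∑ i : Fin n, (f i).1.card = k}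

/-- **THE BOX-STANDARD MONOMIAL** `stdmon j f := Π_{i<j} emb_i(x_{S_i∖A_i} ∧ y_{A_i})` (gen 6's ordered product over the factors). -/
noncomputable def stdmon (j : ℕ) (f : BI m) : HT K (Gen m) :=
  prodR K (fun i => if h : i < n then emb K (facEmb m ⟨i, h⟩) (smon K (f ⟨i, h⟩).1 (f ⟨i, h⟩).2) else 1) j

/-- no factors: the empty product. -/
lemma stdmon_zero (f : BI m) : stdmon K m 0 f = 1 := rfl

/-- one more factor. -/
lemma stdmon_succ {j : ℕ} (hj : j < n) (f : BI m) :
    stdmon K m (j + 1) f = stdmon K m j f * emb K (facEmb m ⟨j, hj⟩) (smon K (f ⟨j, hj⟩).1 (f ⟨j, hj⟩).2) := by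
  rw [stdmon, prodR_succ, dif_pos hj]; rfl

/-- the box-standard monomial of the first `j` factors only sees the slots below `j`. -/
lemma stdmon_congr {j : ℕ} {f g : BI m} (h : ∀ i : Fin n, (i : ℕ) < j → f i = g i) : stdmon K m j f = stdmon K m j g := by
  refine prodR_congr K fun i hi => ?_
  by_cases hin : i < n
  · simp only [dif_pos hin, h ⟨i, hin⟩ hi]
  · simp only [dif_neg hin]

/-- updating slot `j` does not change the monomial of the first `j` factors. -/
lemma stdmon_update {j : ℕ} (hj : j < n) (f : BI m) (v : Finset (Fin (m ⟨j, hj⟩)) × Fin (m ⟨j, hj⟩ + 1)) :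
    stdmon K m j (Function.update f ⟨j, hj⟩ v) = stdmon K m j f :=
  stdmon_congr K m fun i hi => Function.update_of_ne (fun h => by have := congrArg Fin.val h; simp at this; omega) _ _

/-- the degree of the first `j` slots. -/
def pdeg (j : ℕ) (f : BI m) : ℕ := ∑ i : Fin n, if (i : ℕ) < j then (f i).1.card else 0

/-- one more slot. -/
lemma pdeg_succ {j : ℕ} (hj : j < n) (f : BI m) : pdeg m (j + 1) f = pdeg m j f + (f ⟨j, hj⟩).1.card := by
  have key : ∀ i : Fin n, (if (i : ℕ) < j + 1 then (f i).1.card else 0) =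
      (if (i : ℕ) < j then (f i).1.card else 0) + (if i = ⟨j, hj⟩ then (f i).1.card else 0) := by
    intro i
    by_cases h1 : (i : ℕ) < j
    · rw [if_pos (by omega), if_pos h1, if_neg (fun h => by have := congrArg Fin.val h; simp at this; omega), add_zero]
    · by_cases h2 : i = ⟨j, hj⟩
      · rw [if_pos (by rw [h2]; simp), if_neg h1, if_pos h2, zero_add]
      · rw [if_neg (fun h => h2 (Fin.ext (by simp; omega))), if_neg h1, if_neg h2, add_zero]
  rw [pdeg, pdeg, Finset.sum_congr rfl fun i _ => key i, Finset.sum_add_distrib,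
    Finset.sum_eq_single_of_mem (⟨j, hj⟩ : Fin n) (Finset.mem_univ _) (fun i _ hi => if_neg hi), if_pos rfl]

/-- for an index of `BIdx j k` the first `j` slots carry the whole degree `k`. -/
lemma pdeg_eq_of_BIdx {j k : ℕ} {f : BI m} (htriv : ∀ i : Fin n, j ≤ (i : ℕ) → f i = (∅, 0)) (hsum : ∑ i : Fin n, (f i).1.card = k) :
    pdeg m j f = k := by
  rw [pdeg, ← hsum]
  refine Finset.sum_congr rfl fun i _ => ?_
  by_cases h : (i : ℕ) < j
  · rw [if_pos h]
  · rw [if_neg h, htriv i (by omega)]; rfl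

/-- bookkeeping: updating slot `i` changes the total size by the size of the new slot. -/
lemma sum_card_update (f : BI m) (i : Fin n) (v : Finset (Fin (m i)) × Fin (m i + 1)) :
    ∑ l : Fin n, ((Function.update f i v) l).1.card + (f i).1.card = ∑ l : Fin n, (f l).1.card + v.1.card := by
  have h1 : ∀ l, ((Function.update f i v) l).1.card = Function.update (fun l => (f l).1.card) i v.1.card l := by
    intro l
    by_cases hl : l = i
    · subst hl; rw [Function.update_self, Function.update_self]
    · rw [Function.update_of_ne hl, Function.update_of_ne hl]
  rw [Finset.sum_congr rfl fun l _ => h1 l, Finset.sum_update_of_mem (Finset.mem_univ i), Finset.sdiff_singleton_eq_erase,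
    ← Finset.add_sum_erase Finset.univ (fun l => (f l).1.card) (Finset.mem_univ i)]
  ring

/-- **every box-standard monomial of the first `j ≤ n` factors lies in `boxStd_j`** (in the degree of its first `j` slots). -/
theorem stdmon_mem_boxStd : ∀ {j : ℕ}, j ≤ n → ∀ (f : BI m), (∀ i : Fin n, ((f i).2 : ℕ) ≤ (f i).1.card) →
    stdmon K m j f ∈ boxStd K m j (pdeg m j f) := by
  intro j
  induction j with
  | zero =>
    intro _ f _
    have h0 : pdeg m 0 f = 0 := Finset.sum_eq_zero fun i _ => by simp
    rw [h0, stdmon_zero, boxStd_zero]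
    have h1 : B K (Gen m) (∅ : Finset (Gen m)) = 1 := by
      rw [B, ExteriorAlgebra.basis_apply_ofCard (b K (Gen m)) Finset.card_empty]; simp [ExteriorAlgebra.ιMulti_family]
    rw [← h1]
    exact B_mem_Hom K (Finset.empty_subset _) Finset.card_empty
  | succ j ih =>
    intro hj f hf
    have hj' : j < n := by omega
    rw [stdmon_succ K m hj', pdeg_succ m hj', boxStd_succ K m hj']
    refine Submodule.mem_iSup_of_mem (pdeg m j f) (Submodule.mem_iSup_of_mem (Finset.mem_range.mpr (by omega))
      (Submodule.mul_mem_mul (ih (by omega) f hf) ?_))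
    rw [Nat.add_sub_cancel_left]
    exact ⟨smon K (f ⟨j, hj'⟩).1 (f ⟨j, hj'⟩).2, smon_mem_repSpan K _ (hf _), rfl⟩

/-- the standard part of a factor is spanned by the embedded standard monomials (spelled with `smon`). -/
lemma R_le_span_smon (i : Fin n) (b : ℕ) :
    R K m i b ≤ Submodule.span K ((fun q : Finset (Fin (m i)) × Fin (m i + 1) => emb K (facEmb m i) (smon K q.1 q.2)) ''
      {q | q.1.card = b ∧ (q.2 : ℕ) ≤ b}) := by
  rw [R, repSpan, Submodule.map_span, Submodule.span_le]
  rintro _ ⟨_, ⟨⟨⟨S, hS⟩, c⟩, rfl⟩, rfl⟩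
  refine Submodule.subset_span ⟨(S, ⟨c, by have := c.2; have := Finset.card_le_univ S; simp only [Fintype.card_fin] at this; omega⟩),
    ⟨hS, by have := c.2; simp only; omega⟩, ?_⟩
  simp only [AlgHom.toLinearMap_apply]
  rfl

/-- **`boxStd_j^k` is spanned by the box-standard monomials indexed by `BIdx j k`.** -/
theorem boxStd_le_span_stdmon : ∀ {j : ℕ}, j ≤ n → ∀ k, boxStd K m j k ≤ Submodule.span K (Set.range fun f : BIdx m j k => stdmon K m j f.1) := by
  intro j
  induction j with
  | zero =>
    intro _ k
    rw [boxStd_zero]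
    by_cases hk : k = 0
    · subst hk
      refine (Hom_empty_le K 0).trans ((Submodule.span_singleton_le_iff_mem _ _).mpr ?_)
      have hf : (fun _ : Fin n => ((∅ : Finset _), (0 : Fin _))) ∈
          {f : BI m | (∀ i : Fin n, 0 ≤ (i : ℕ) → f i = (∅, 0)) ∧ (∀ i : Fin n, ((f i).2 : ℕ) ≤ (f i).1.card) ∧ ∑ i : Fin n, (f i).1.card = 0} :=
        ⟨fun _ _ => rfl, fun _ => by simp, by simp⟩
      exact Submodule.subset_span ⟨⟨_, hf⟩, stdmon_zero K m _⟩
    · rw [Hom_empty_of_ne K hk]; exact bot_le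
  | succ j ih =>
    intro hj k
    have hj' : j < n := by omega
    rw [boxStd_succ K m hj']
    refine iSup₂_le fun a ha => ?_
    refine (mul_le_mul' (ih (by omega) a) (R_le_span_smon K m ⟨j, hj'⟩ (k - a))).trans ?_
    rw [Submodule.span_mul_span, Submodule.span_le]
    rintro _ ⟨_, ⟨⟨f, hfj, hfy, hfs⟩, rfl⟩, _, ⟨⟨S, c⟩, ⟨hS, hc⟩, rfl⟩, rfl⟩
    simp only at hS hc
    -- the product is the box-standard monomial of the updated index
    set f' : BI m := Function.update f ⟨j, hj'⟩ (S, c) with hf'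
    have hmem : f' ∈ {f : BI m | (∀ i : Fin n, j + 1 ≤ (i : ℕ) → f i = (∅, 0)) ∧ (∀ i : Fin n, ((f i).2 : ℕ) ≤ (f i).1.card) ∧
        ∑ i : Fin n, (f i).1.card = k} := by
      refine ⟨fun i hi => ?_, fun i => ?_, ?_⟩
      · rw [hf', Function.update_of_ne (fun h => by have := congrArg Fin.val h; simp at this; omega)]
        exact hfj i (by omega)
      · by_cases hi : i = ⟨j, hj'⟩
        · subst hi; rw [hf', Function.update_self]; simpa [hS] using hc
        · rw [hf', Function.update_of_ne hi]; exact hfy i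
      · have h1 := sum_card_update m f ⟨j, hj'⟩ (S, c)
        have h2 : (f ⟨j, hj'⟩).1.card = 0 := by rw [hfj ⟨j, hj'⟩ le_rfl]; rfl
        have ha' := Finset.mem_range.mp ha
        rw [hfs, h2, hS, ← hf'] at h1
        show ∑ i : Fin n, (f' i).1.card = k
        omega
    have heq : stdmon K m j f * emb K (facEmb m ⟨j, hj'⟩) (smon K S c) = stdmon K m (j + 1) f' := by
      rw [stdmon_succ K m hj', hf', stdmon_update K m hj', Function.update_self]
    show stdmon K m j f * emb K (facEmb m ⟨j, hj'⟩) (smon K S c) ∈ _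
    rw [heq]
    exact Submodule.subset_span ⟨⟨f', hmem⟩, rfl⟩

/-- **`span{box-standard monomials of BIdx j k} = boxStd_j^k`** (`j ≤ n`). -/
theorem span_stdmon {j : ℕ} (hj : j ≤ n) (k : ℕ) :
    Submodule.span K (Set.range fun f : BIdx m j k => stdmon K m j f.1) = boxStd K m j k := by
  refine le_antisymm ?_ (boxStd_le_span_stdmon K m hj k)
  rw [Submodule.span_le]
  rintro _ ⟨f, rfl⟩
  have h := stdmon_mem_boxStd K m hj f.1 f.2.2.1
  rwa [pdeg_eq_of_BIdx m f.2.1 f.2.2.2] at h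

/-! ## §17. The box-standard monomials are linearly independent -/

/-- the embedded standard monomials of factor `i` with pair sets of size `b` (and `y`-count `≤ b`) are linearly independent. -/
lemma linearIndependent_emb_smon (i : Fin n) (b : ℕ) :
    LinearIndependent K fun q : {q : Finset (Fin (m i)) × Fin (m i + 1) // q.1.card = b ∧ (q.2 : ℕ) ≤ b} =>
      emb K (facEmb m i) (smon K q.1.1 q.1.2) := by
  let ψ : {q : Finset (Fin (m i)) × Fin (m i + 1) // q.1.card = b ∧ (q.2 : ℕ) ≤ b} → RIdx (m i) b :=
    fun q => (⟨q.1.1, q.2.1⟩, ⟨q.1.2, Nat.lt_succ_of_le q.2.2⟩)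
  have hψ : Function.Injective ψ := by
    rintro ⟨⟨S, c⟩, hS⟩ ⟨⟨S', c'⟩, hS'⟩ h
    simp only [ψ, Prod.mk.injEq, Subtype.mk.injEq, Fin.mk.injEq] at h
    exact Subtype.ext (Prod.ext h.1 (Fin.ext h.2))
  have h := ((linearIndependent_rep K (n := m i) b).map' (emb K (facEmb m i)).toLinearMap
    (LinearMap.ker_eq_bot.mpr (emb_injective K (facEmb m i)))).comp ψ hψ
  have heq : (fun q : {q : Finset (Fin (m i)) × Fin (m i + 1) // q.1.card = b ∧ (q.2 : ℕ) ≤ b} =>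
      emb K (facEmb m i) (smon K q.1.1 q.1.2)) = (⇑(emb K (facEmb m i)).toLinearMap ∘ rep K) ∘ ψ := funext fun q => rfl
  rw [heq]
  exact h

/-- **THE BOX-STANDARD MONOMIALS OF THE FIRST `j ≤ n` FACTORS ARE LINEARLY INDEPENDENT** (th-7's `linearIndependent_mul` iterated: the degree on the earlier blocks
separates, the last block carries gen 11's independent standard monomials). -/
theorem linearIndependent_stdmon : ∀ {j : ℕ}, j ≤ n → ∀ k, LinearIndependent K fun f : BIdx m j k => stdmon K m j f.1 := by
  classical
  intro j
  induction j with
  | zero =>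
    intro _ k
    rw [Fintype.linearIndependent_iff]
    intro g hg f
    -- at `j = 0` all slots are idle: `k = 0` and the index is unique; the monomial is `1`
    obtain ⟨f₀, hf0, hy0, hsum⟩ := f
    have hfun : ∀ f' : BIdx m 0 k, f' = ⟨f₀, hf0, hy0, hsum⟩ := by
      rintro ⟨f', hf', -, -⟩
      apply Subtype.ext
      funext i
      show f' i = f₀ i
      rw [hf' i (Nat.zero_le _), hf0 i (Nat.zero_le _)]
    simp_rw [stdmon_zero] at hg
    rw [Finset.sum_eq_single (⟨f₀, hf0, hy0, hsum⟩ : BIdx m 0 k) (fun f' _ hne => absurd (hfun f') hne)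
      (fun h => absurd (Finset.mem_univ _) h), smul_eq_zero] at hg
    exact hg.resolve_right one_ne_zero
  | succ j ih =>
    intro hj k
    have hj' : j < n := by omega
    set jf : Fin n := ⟨j, hj'⟩ with hjf
    -- the product family of th-7's lemma
    let ι : Fin (k + 1) → Type := fun a => BIdx m j a
    let κ : Fin (k + 1) → Type := fun a => {q : Finset (Fin (m jf)) × Fin (m jf + 1) // q.1.card = k - a ∧ (q.2 : ℕ) ≤ k - a}
    let v : (a : Fin (k + 1)) → ι a → HT K (Gen m) := fun a f => stdmon K m j f.1
    let w : (a : Fin (k + 1)) → κ a → HT K (Gen m) := fun a q => emb K (facEmb m jf) (smon K q.1.1 q.1.2)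
    have hv : ∀ a (f : ι a), v a f ∈ Hom K (Gen m) (pre m j) a := by
      intro a f
      have h := boxStd_le_Hom K m (j := j) (by omega) _ (stdmon_mem_boxStd K m (j := j) (by omega) f.1 f.2.2.1)
      rwa [pdeg_eq_of_BIdx m f.2.1 f.2.2.2] at h
    have hw : ∀ a (q : κ a), w a q ∈ Hom K (Gen m) (blk m j) (k - a) := by
      intro a q
      have h := R_le_Hom K m jf _ ⟨smon K q.1.1 q.1.2, smon_mem_repSpan K _ (by have := q.2; omega), rfl⟩
      rwa [q.2.1] at h
    have hli := linearIndependent_mul K (disjoint_pre_blk m hj') (m := k + 1) (fun a => (a : ℕ)) (fun a => k - a)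
      Fin.val_injective v w hv hw (fun a => ih (by omega) a) (fun a => linearIndependent_emb_smon K m jf (k - a))
    -- reindex along `f ↦ (degree below j, f reset at slot j, slot j)`
    have hcard : ∀ f : BIdx m (j + 1) k, (f.1 jf).1.card ≤ k := fun f => by
      have h1 : (f.1 jf).1.card ≤ ∑ i : Fin n, (f.1 i).1.card :=
        Finset.single_le_sum (f := fun i => (f.1 i).1.card) (fun i _ => Nat.zero_le _) (Finset.mem_univ jf)
      have h2 := f.2.2.2
      omega
    have hreset : ∀ f : BIdx m (j + 1) k, Function.update f.1 jf (∅, 0) ∈ {g : BI m | (∀ i : Fin n, j ≤ (i : ℕ) → g i = (∅, 0)) ∧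
        (∀ i : Fin n, ((g i).2 : ℕ) ≤ (g i).1.card) ∧ ∑ i : Fin n, (g i).1.card = k - (f.1 jf).1.card} := by
      rintro ⟨f, hfj, hfy, hfs⟩
      refine ⟨fun i hi => ?_, fun i => ?_, ?_⟩
      · by_cases hij : i = jf
        · subst hij; rw [Function.update_self]
        · rw [Function.update_of_ne hij]; exact hfj i (by have : (i : ℕ) ≠ j := fun h => hij (Fin.ext h); omega)
      · by_cases hij : i = jf
        · subst hij; rw [Function.update_self]; simp
        · rw [Function.update_of_ne hij]; exact hfy i
      · have h1 := sum_card_update m f jf (∅, 0)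
        simp only [Finset.card_empty, add_zero] at h1
        simp only at hfs ⊢
        omega
    let ψ : BIdx m (j + 1) k → (Σ a, ι a × κ a) := fun f =>
      ⟨⟨k - (f.1 jf).1.card, by omega⟩, (⟨Function.update f.1 jf (∅, 0), hreset f⟩,
        ⟨f.1 jf, by have := hcard f; simp only; omega, by have := f.2.2.1 jf; have := hcard f; simp only; omega⟩)⟩
    have hφψ : ∀ f : BIdx m (j + 1) k, Function.update (ψ f).2.1.1 jf (ψ f).2.2.1 = f.1 := by
      intro f
      funext i
      by_cases hij : i = jf
      · subst hij; rw [Function.update_self]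
      · rw [Function.update_of_ne hij]; exact Function.update_of_ne hij _ _
    have hψ : Function.Injective ψ := by
      intro f g h
      apply Subtype.ext
      rw [← hφψ f, ← hφψ g, h]
    have hcomp : (fun x : Σ a, ι a × κ a => v x.1 x.2.1 * w x.1 x.2.2) ∘ ψ = fun f : BIdx m (j + 1) k => stdmon K m (j + 1) f.1 := by
      funext f
      simp only [Function.comp_apply, v, w, ψ]
      rw [stdmon_succ K m hj', stdmon_update K m hj']
    rw [← hcomp]
    exact hli.comp ψ hψ

include K in
/-- **`#BIdx j k = cnt j k = [t^k] Π_{i<j} G_{m_i}`**: the count of (2/3) is the number of box-standard monomials (no separate counting argument: independence + span). -/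
theorem card_BIdx {j : ℕ} (hj : j ≤ n) (k : ℕ) : Fintype.card (BIdx m j k) = cnt m j k := by
  rw [← finrank_boxStd K m hj k, ← span_stdmon K m hj k, finrank_span_eq_card (linearIndependent_stdmon K m hj k)]

/-- **THE BOX-STANDARD MONOMIALS ARE A BASIS OF A COMPLEMENT OF THE BOX SIEGEL IDEAL: `⋀^k = span{stdmon n f : f ∈ BIdx n k} ⊔ boxSiegelIdeal_k`**, the span
meeting the ideal trivially, with `#BIdx n k = [t^k] Π_i G_{m_i}(t)` independent generators. -/
theorem exteriorPower_eq_span_stdmon_sup (k : ℕ) :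
    (⋀[K]^k (Gen m → K) : Submodule K (HT K (Gen m))) =
      Submodule.span K (Set.range fun f : BIdx m n k => stdmon K m n f.1) ⊔ boxSiegelIdeal K m k := by
  rw [span_stdmon K m le_rfl, boxStd_sup_boxSiegelIdeal]

/-- … with trivial intersection. -/
theorem span_stdmon_inf_boxSiegelIdeal (k : ℕ) :
    Submodule.span K (Set.range fun f : BIdx m n k => stdmon K m n f.1) ⊓ boxSiegelIdeal K m k = ⊥ := by
  rw [span_stdmon K m le_rfl, boxStd_inf_boxSiegelIdeal]

include K in
/-- **the number of box-standard monomials of degree `k` is `[t^k] Π_i G_{m_i}(t)`**, `G_m(t) = Σ_b (b+1)·C(m,b)·t^b`. -/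
theorem card_BIdx_top (k : ℕ) : Fintype.card (BIdx m n k) = (∏ i : Fin n, stdPoly (m i)).coeff k := by
  rw [card_BIdx K m le_rfl, cnt_top]

end Box

end Summit.Ventures.HSemireg.Wedge.HankelBoxSiegelIdeal
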